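import Mathlib
import HarnessLib

/-!
# Newman's entire function is complex-differentiable everywhere

Stub `stub_newmanDifferentiable` of line `potential-flow-essential-singularity` for crux
`stmt-AnomalousDissipation-3009` (`MarginalStabilityChain.StretchedVortexRows`).

Newman's function `N(z) = ∫_ℝ exp(z eᵗ - t eᵗ + t) dt` (`= ∫₀^∞ e^{zs} s^{-s} ds` after `s = eᵗ`;
D. J. Newman, Amer. Math. Monthly 83 (1976) 192–193) is entire.

Proof outline: differentiation under the integral sign
(`hasDerivAt_integral_of_dominated_loc_of_deriv_le`) at every `z₀`, on the ball of radius `1`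
around `z₀`.  The `z`-derivative of the kernel is the kernel times `eᵗ`; its norm is
`exp (Re z · eᵗ - t eᵗ + 2t) ≤ exp ((Re z₀ + 1) eᵗ - t eᵗ + 2t)` on the ball.  The only real work
is the integrability on `ℝ` of `t ↦ exp (a eᵗ - t eᵗ + k t)` for real `a` and `k ≥ 1`, which
follows from the elementary inequality `b eᵗ - t eᵗ ≤ e^{b-1}` (from `1 + x ≤ eˣ`): on `(-∞, 0]`
the integrand is `≤ exp (e^{a-1}) · eᵗ`, on `(0, ∞)` it is `≤ exp (e^{a+k}) · e^{-t}`.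
-/

set_option linter.dupNamespace false

noncomputable section

open scoped Topology ENNReal Real
open Filter Set Function MeasureTheory Complex

namespace Summit.AnomalousDissipation.AnomalousDissipation.Theorems
namespace MarginalStabilityChainStretchedVortexRows
namespace PotentialFlow

/-- The elementary inequality `b eᵗ - t eᵗ ≤ e^{b-1}` (i.e. `b s - s log s ≤ e^{b-1}` for
`s > 0`), a consequence of `1 + x ≤ eˣ` with `x = b - 1 - t`. [folklore] -/
theorem newmanDifferentiable_linear_sub_mul_exp_le (b τ : ℝ) :
    b * Real.exp τ - τ * Real.exp τ ≤ Real.exp (b - 1) := by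
  have h1 : b - 1 - τ + 1 ≤ Real.exp (b - 1 - τ) := Real.add_one_le_exp (b - 1 - τ)
  have h2 : Real.exp τ * (b - 1 - τ + 1) ≤ Real.exp τ * Real.exp (b - 1 - τ) :=
    mul_le_mul_of_nonneg_left h1 (Real.exp_pos τ).le
  rw [← Real.exp_add] at h2
  have h3 : τ + (b - 1 - τ) = b - 1 := by ring
  rw [h3] at h2
  linarith

/-- Pointwise bound on `(-∞, 0]`: `exp (a eᵗ - t eᵗ + k t) ≤ exp (e^{a-1}) · eᵗ` for `t ≤ 0`,
`k ≥ 1`. [folklore] -/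
theorem newmanDifferentiable_bound_Iic (a k τ : ℝ) (hk : 1 ≤ k) (hτ : τ ≤ 0) :
    Real.exp (a * Real.exp τ - τ * Real.exp τ + k * τ) ≤
      Real.exp (Real.exp (a - 1)) * Real.exp τ := by
  rw [← Real.exp_add, Real.exp_le_exp]
  have h1 := newmanDifferentiable_linear_sub_mul_exp_le a τ
  have h2 : k * τ ≤ τ := by nlinarith
  linarith

/-- Pointwise bound everywhere (used on `(0, ∞)`):
`exp (a eᵗ - t eᵗ + k t) ≤ exp (e^{a+k}) · e^{-t}` for `k ≥ 1`, using
`(a + k + 1) eᵗ - t eᵗ ≤ e^{a+k}` and `t ≤ eᵗ`. [folklore] -/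
theorem newmanDifferentiable_bound_Ioi (a k τ : ℝ) (hk : 1 ≤ k) :
    Real.exp (a * Real.exp τ - τ * Real.exp τ + k * τ) ≤
      Real.exp (Real.exp (a + k)) * Real.exp (-τ) := by
  rw [← Real.exp_add, Real.exp_le_exp]
  have h1 := newmanDifferentiable_linear_sub_mul_exp_le (a + k + 1) τ
  have h2 : τ + 1 ≤ Real.exp τ := Real.add_one_le_exp τ
  have h3 : a + k + 1 - 1 = a + k := by ring
  rw [h3] at h1
  nlinarith

/-- Integrability on `ℝ` of `t ↦ exp (a eᵗ - t eᵗ + k t)` for real `a` and `k ≥ 1`: comparison with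
`C eᵗ` on `(-∞, 0]` and with `C' e^{-t}` on `(0, ∞)`. [folklore] -/
theorem newmanDifferentiable_integrable (a k : ℝ) (hk : 1 ≤ k) :
    Integrable (fun τ : ℝ => Real.exp (a * Real.exp τ - τ * Real.exp τ + k * τ)) := by
  have hcont : Continuous (fun τ : ℝ => Real.exp (a * Real.exp τ - τ * Real.exp τ + k * τ)) := by
    fun_prop
  have hIic : IntegrableOn (fun τ : ℝ => Real.exp (a * Real.exp τ - τ * Real.exp τ + k * τ))
      (Iic 0) := by
    refine Integrable.mono' ((integrableOn_exp_Iic 0).const_mul (Real.exp (Real.exp (a - 1))))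
      hcont.aestronglyMeasurable ?_
    refine ae_restrict_of_forall_mem measurableSet_Iic fun τ hτ => ?_
    rw [Real.norm_eq_abs, abs_of_pos (Real.exp_pos _)]
    exact newmanDifferentiable_bound_Iic a k τ hk hτ
  have hIoi : IntegrableOn (fun τ : ℝ => Real.exp (a * Real.exp τ - τ * Real.exp τ + k * τ))
      (Ioi 0) := by
    refine Integrable.mono' ((integrableOn_exp_neg_Ioi 0).const_mul (Real.exp (Real.exp (a + k))))
      hcont.aestronglyMeasurable ?_
    refine ae_restrict_of_forall_mem measurableSet_Ioi fun τ _ => ?_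
    rw [Real.norm_eq_abs, abs_of_pos (Real.exp_pos _)]
    exact newmanDifferentiable_bound_Ioi a k τ hk
  have h := hIic.union hIoi
  rwa [Iic_union_Ioi, integrableOn_univ] at h

/-- Norm of Newman's kernel: `‖exp (z eᵗ - t eᵗ + t)‖ = exp (Re z · eᵗ - t eᵗ + t)` for real `t`.
[folklore] -/
theorem newmanDifferentiable_norm_kernel (z : ℂ) (τ : ℝ) :
    ‖Complex.exp (z * Complex.exp (τ : ℂ) - (τ : ℂ) * Complex.exp (τ : ℂ) + (τ : ℂ))‖ =
      Real.exp (z.re * Real.exp τ - τ * Real.exp τ + τ) := by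
  rw [Complex.norm_exp]
  congr 1
  rw [← Complex.ofReal_exp]
  simp only [add_re, sub_re, mul_re, ofReal_re, ofReal_im, mul_zero, sub_zero]

/-- The `z`-derivative of Newman's kernel:
`d/dz exp (z eᵗ - t eᵗ + t) = exp (z eᵗ - t eᵗ + t) · eᵗ`. [folklore] -/
theorem newmanDifferentiable_hasDerivAt_kernel (z : ℂ) (τ : ℝ) :
    HasDerivAt
      (fun x : ℂ => Complex.exp (x * Complex.exp (τ : ℂ) - (τ : ℂ) * Complex.exp (τ : ℂ) + (τ : ℂ)))
      (Complex.exp (z * Complex.exp (τ : ℂ) - (τ : ℂ) * Complex.exp (τ : ℂ) + (τ : ℂ)) *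
        Complex.exp (τ : ℂ)) z := by
  have h := ((((hasDerivAt_id' z).mul_const (Complex.exp (τ : ℂ))).sub_const
    ((τ : ℂ) * Complex.exp (τ : ℂ))).add_const (τ : ℂ)).cexp
  rwa [one_mul] at h

/-- **Stub 1.** Newman's function `N(z) = ∫_ℝ exp(z eᵗ - t eᵗ + t) dt` is entire
(differentiation under the integral sign, dominated on balls); D. J. Newman, Amer. Math. Monthly 83
(1976) 192–193. [folklore] -/
theorem stub_newmanDifferentiable :
    Differentiable ℂ (fun z : ℂ => ∫ τ : ℝ,
      Complex.exp (z * Complex.exp (τ : ℂ) - (τ : ℂ) * Complex.exp (τ : ℂ) + (τ : ℂ))) := by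
  intro z₀
  have key := hasDerivAt_integral_of_dominated_loc_of_deriv_le (𝕜 := ℂ) (μ := (volume : Measure ℝ))
    (F := fun (z : ℂ) (τ : ℝ) =>
      Complex.exp (z * Complex.exp (τ : ℂ) - (τ : ℂ) * Complex.exp (τ : ℂ) + (τ : ℂ)))
    (F' := fun (z : ℂ) (τ : ℝ) =>
      Complex.exp (z * Complex.exp (τ : ℂ) - (τ : ℂ) * Complex.exp (τ : ℂ) + (τ : ℂ)) *
        Complex.exp (τ : ℂ))
    (x₀ := z₀) (s := Metric.ball z₀ 1)
    (bound := fun τ : ℝ =>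
      Real.exp ((z₀.re + 1) * Real.exp τ - τ * Real.exp τ + τ) * Real.exp τ)
    (Metric.ball_mem_nhds z₀ one_pos) ?_ ?_ ?_ ?_ ?_ ?_
  · exact key.2.differentiableAt
  · -- measurability of `F z` near `z₀`
    exact Eventually.of_forall fun z =>
      (by fun_prop : Continuous fun τ : ℝ =>
        Complex.exp (z * Complex.exp (τ : ℂ) - (τ : ℂ) * Complex.exp (τ : ℂ) +
          (τ : ℂ))).aestronglyMeasurable
  · -- integrability of `F z₀`
    refine Integrable.mono' (newmanDifferentiable_integrable z₀.re 1 le_rfl)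
      (by fun_prop : Continuous fun τ : ℝ =>
        Complex.exp (z₀ * Complex.exp (τ : ℂ) - (τ : ℂ) * Complex.exp (τ : ℂ) +
          (τ : ℂ))).aestronglyMeasurable
      (Eventually.of_forall fun τ => ?_)
    rw [newmanDifferentiable_norm_kernel, one_mul]
  · -- measurability of `F' z₀`
    exact (by fun_prop : Continuous fun τ : ℝ =>
      Complex.exp (z₀ * Complex.exp (τ : ℂ) - (τ : ℂ) * Complex.exp (τ : ℂ) + (τ : ℂ)) *
        Complex.exp (τ : ℂ)).aestronglyMeasurable
  · -- domination of `F' z` on the ball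
    refine Eventually.of_forall fun τ z hz => ?_
    have hz' : ‖z - z₀‖ < 1 := by rwa [← dist_eq_norm]
    have hre : z.re ≤ z₀.re + 1 := by
      have h1 := abs_re_le_norm (z - z₀)
      rw [sub_re] at h1
      have h2 := le_abs_self (z.re - z₀.re)
      linarith
    rw [norm_mul, newmanDifferentiable_norm_kernel, Complex.norm_exp, ofReal_re]
    gcongr
  · -- integrability of the bound
    have h := newmanDifferentiable_integrable (z₀.re + 1) 2 (by norm_num)
    refine h.congr (Eventually.of_forall fun τ => ?_)
    simp only
    rw [← Real.exp_add]
    congr 1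
    ring
  · -- differentiability of the kernel in `z`
    exact Eventually.of_forall fun τ z _ => newmanDifferentiable_hasDerivAt_kernel z τ

end PotentialFlow
end MarginalStabilityChainStretchedVortexRows
end Summit.AnomalousDissipation.AnomalousDissipation.Theorems
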